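import Summits.HubbardSuperconductivity.HubbardSuperconductivity.Theorems.TwSeededEnsembleEquivalence.Negative.BetaMonotonicity

/-!
# drefute gen 2 — line `exposed-density-duality`, transfer half (T1): ground-energy limit from pressure limits

Mutation artifact for the lead (crux stmt-HubbardSuperconductivity-1698). The transfer
`stub_exposedDensityT0` asks, besides the exposed slope (T2), for the EXISTENCE (T1) of
`lim_L E₀(Hgc_L(μ))/L²`. The tree's entropy sandwich (Negative/BetaMonotonicity:
`neg_mul_groundEnergy_le_log_partitionFn`, `log_partitionFn_le_log_card_sub`, `log_card_fock`) gives,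
with `x_L = E₀(Hgc_L(μ))/L²` and `p_L(β) = Re log Z(β, Hgc_L(μ))/(βL²)`,

    −p_L(β) ≤ x_L ≤ −p_L(β) + log 4/β   for every β ≥ 1 and every L,

so (T1) follows from the convergence of the finite-temperature pressures `p_L(β)` for each `β ≥ 1`
(route item `TwApproximatingHamiltonian` + the thermodynamic limit of the short-range sourced pressure)
by the purely real-variable lemma below: NO zero-temperature input is needed for (T1).
-/

open Filter Topology

set_option linter.dupNamespace false

namespace Summit.HubbardSuperconductivity.HubbardSuperconductivity.Cruxes.TwSeededEnsembleEquivalence.DrefuteSandwichLimit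

/-- **Sandwich ⇒ limit.** If a real sequence `x` is squeezed, for every `β ≥ 1`, between `−p β` and
`−p β + c/β`, and each sequence `p β` (`β ≥ 1`) converges, then `x` converges. (Cauchy criterion:
`|x L − x L'| ≤ 2|c|/β + |p β L − p β L'|`.) -/
theorem tendsto_of_pressure_sandwich (x : ℕ → ℝ) (p : ℝ → ℕ → ℝ) (c : ℝ)
    (hsand : ∀ β : ℝ, 1 ≤ β → ∀ L : ℕ, -p β L ≤ x L ∧ x L ≤ -p β L + c / β)
    (hlim : ∀ β : ℝ, 1 ≤ β → ∃ P : ℝ, Tendsto (p β) atTop (𝓝 P)) :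
    ∃ e : ℝ, Tendsto x atTop (𝓝 e) := by
  have hc : CauchySeq x := by
    refine Metric.cauchySeq_iff.2 fun ε hε => ?_
    -- choose β ≥ 1 with |c|/β < ε/3
    obtain ⟨β, hβ1, hβc⟩ : ∃ β : ℝ, 1 ≤ β ∧ |c| / β < ε / 3 := by
      refine ⟨max 1 (3 * |c| / ε + 1), le_max_left _ _, ?_⟩
      have hpos : 0 < max 1 (3 * |c| / ε + 1) := lt_of_lt_of_le one_pos (le_max_left _ _)
      rw [div_lt_iff₀ hpos]
      have h1 : 3 * |c| / ε + 1 ≤ max 1 (3 * |c| / ε + 1) := le_max_right _ _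
      have h2 : |c| < ε / 3 * (3 * |c| / ε + 1) := by
        have : ε / 3 * (3 * |c| / ε + 1) = |c| + ε / 3 := by field_simp
        rw [this]; linarith
      calc |c| < ε / 3 * (3 * |c| / ε + 1) := h2
        _ ≤ ε / 3 * max 1 (3 * |c| / ε + 1) := by gcongr
    obtain ⟨P, hP⟩ := hlim β hβ1
    have hCp : CauchySeq (p β) := hP.cauchySeq
    obtain ⟨N, hN⟩ := Metric.cauchySeq_iff.1 hCp (ε / 3) (by positivity)
    refine ⟨N, fun m hm n hn => ?_⟩
    have hmn := hN m hm n hn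
    rw [Real.dist_eq] at hmn ⊢
    obtain ⟨hm1, hm2⟩ := hsand β hβ1 m
    obtain ⟨hn1, hn2⟩ := hsand β hβ1 n
    have hβpos : 0 < β := lt_of_lt_of_le one_pos hβ1
    have hcb : c / β ≤ |c| / β := div_le_div_of_nonneg_right (le_abs_self c) hβpos.le
    have h3 := neg_abs_le (p β m - p β n)
    have h4 := le_abs_self (p β m - p β n)
    have h5 := le_abs_self c
    have h6 := neg_abs_le c
    have hcb' : -(|c| / β) ≤ c / β := by
      rw [← neg_div]; exact div_le_div_of_nonneg_right h6 hβpos.le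
    have key : |x m - x n| ≤ |c| / β + |p β m - p β n| := by
      rw [abs_le]
      constructor
      · linarith
      · linarith
    linarith
  exact cauchySeq_tendsto_of_complete hc

/-- The same with the sandwich only EVENTUALLY in `L` (for each `β`), which is the form in which a
thermodynamic-limit statement is usually available. -/
theorem tendsto_of_eventual_pressure_sandwich (x : ℕ → ℝ) (p : ℝ → ℕ → ℝ) (c : ℝ)
    (hsand : ∀ β : ℝ, 1 ≤ β → ∀ᶠ L in atTop, -p β L ≤ x L ∧ x L ≤ -p β L + c / β)
    (hlim : ∀ β : ℝ, 1 ≤ β → ∃ P : ℝ, Tendsto (p β) atTop (𝓝 P)) :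
    ∃ e : ℝ, Tendsto x atTop (𝓝 e) := by
  -- repair the sandwich at the finitely many bad `L` by redefining `p β` there
  classical
  let p' : ℝ → ℕ → ℝ := fun β L => if -p β L ≤ x L ∧ x L ≤ -p β L + c / β then p β L else -x L
  have hsand' : ∀ β : ℝ, 1 ≤ β → ∀ L : ℕ, -p' β L ≤ x L ∧ x L ≤ -p' β L + c / β := by
    intro β hβ L
    by_cases h : -p β L ≤ x L ∧ x L ≤ -p β L + c / β
    · simp only [p', h, and_self, if_true]
    · simp only [p', h, if_false, neg_neg, le_refl, true_and]
      -- need 0 ≤ c/β: from the sandwich holding at SOME L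
      obtain ⟨L₀, hL₀⟩ := (hsand β hβ).exists
      have : 0 ≤ c / β := by linarith [hL₀.1, hL₀.2]
      linarith
  have hlim' : ∀ β : ℝ, 1 ≤ β → ∃ P : ℝ, Tendsto (p' β) atTop (𝓝 P) := by
    intro β hβ
    obtain ⟨P, hP⟩ := hlim β hβ
    refine ⟨P, hP.congr' ?_⟩
    filter_upwards [hsand β hβ] with L hL
    simp only [p', hL, and_self, if_true]
  exact tendsto_of_pressure_sandwich x p' c hsand' hlim'

/-! ## Instantiation: (T1) of `stub_exposedDensityT0` from the convergence of the seeded pressures -/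

section Seeded

open Matrix Literature.MathematicalPhysics.QuantumLattice
open Summit.HubbardSuperconductivity.HubbardSuperconductivity.Theorems.TwSeededEnsembleEquivalence.Negative
open scoped ComplexOrder

/-- **(T1) from finite-temperature pressure limits.** For the seeded grand-canonical Hamiltonian
`Hgc_L(μ) = hubbardTorusWith 2 L 1 U μ − (g/L²) Δ_dᴴΔ_d` (literal transfer terms, indexed by `L+1`
as in `stub_exposedDensityT0`): if for every `β ≥ 1` the pressure `Re log Z(β, Hgc_{L+1}(μ))/(β(L+1)²)`
converges as `L → ∞`, then the ground-energy density `E₀(Hgc_{L+1}(μ))/(L+1)²` converges. The only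
input is the entropy sandwich `−βE₀ ≤ log Z ≤ L² log 4 − βE₀` (Negative/BetaMonotonicity). -/
theorem seededGC_groundEnergyDensity_tendsto_of_pressure_tendsto (U μ g : ℝ)
    (hp : ∀ β : ℝ, 1 ≤ β → ∃ P : ℝ, Tendsto (fun L : ℕ =>
      Real.log ((hubbardTorusWith 2 (L + 1) 1 U μ - ((g / ((L + 1 : ℕ) : ℝ) ^ 2 : ℝ) : ℂ) •
        ((pairField dWaveFormFactor (L + 1))ᴴ * pairField dWaveFormFactor (L + 1))).partitionFn β).re /
        (β * ((L + 1 : ℕ) : ℝ) ^ 2)) atTop (𝓝 P)) :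
    ∃ e : ℝ, Tendsto (fun L : ℕ =>
      (hubbardTorusWith 2 (L + 1) 1 U μ - ((g / ((L + 1 : ℕ) : ℝ) ^ 2 : ℝ) : ℂ) •
        ((pairField dWaveFormFactor (L + 1))ᴴ * pairField dWaveFormFactor (L + 1))).groundEnergy /
        ((L + 1 : ℕ) : ℝ) ^ 2) atTop (𝓝 e) := by
  refine tendsto_of_pressure_sandwich _ (fun β L =>
      Real.log ((hubbardTorusWith 2 (L + 1) 1 U μ - ((g / ((L + 1 : ℕ) : ℝ) ^ 2 : ℝ) : ℂ) •
        ((pairField dWaveFormFactor (L + 1))ᴴ * pairField dWaveFormFactor (L + 1))).partitionFn β).re /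
        (β * ((L + 1 : ℕ) : ℝ) ^ 2)) (Real.log 4) (fun β hβ L => ?_) hp
  set H := hubbardTorusWith 2 (L + 1) 1 U μ - ((g / ((L + 1 : ℕ) : ℝ) ^ 2 : ℝ) : ℂ) •
    ((pairField dWaveFormFactor (L + 1))ᴴ * pairField dWaveFormFactor (L + 1)) with hH
  have hHerm : H.IsHermitian := isHermitian_seededGC (L + 1) U μ g
  have hβ0 : 0 < β := lt_of_lt_of_le one_pos hβ
  have hL : (0 : ℝ) < ((L + 1 : ℕ) : ℝ) ^ 2 := by positivity
  have hβL : 0 < β * ((L + 1 : ℕ) : ℝ) ^ 2 := mul_pos hβ0 hL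
  have h1 : -(β * H.groundEnergy) ≤ Real.log (H.partitionFn β).re :=
    neg_mul_groundEnergy_le_log_partitionFn hHerm β
  have h2 : Real.log (H.partitionFn β).re ≤
      Real.log (Fintype.card (Finset (Orb (FermionTorus 2 (L + 1))))) - β * H.groundEnergy :=
    log_partitionFn_le_log_card_sub hHerm hβ0.le
  rw [log_card_fock (L + 1)] at h2
  have e1 : -(β * H.groundEnergy) / (β * ((L + 1 : ℕ) : ℝ) ^ 2) ≤
      Real.log (H.partitionFn β).re / (β * ((L + 1 : ℕ) : ℝ) ^ 2) :=
    div_le_div_of_nonneg_right h1 hβL.le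
  have e1' : -(β * H.groundEnergy) / (β * ((L + 1 : ℕ) : ℝ) ^ 2) =
      -(H.groundEnergy / ((L + 1 : ℕ) : ℝ) ^ 2) := by
    rw [neg_div, mul_div_mul_left _ _ hβ0.ne']
  have e2 : Real.log (H.partitionFn β).re / (β * ((L + 1 : ℕ) : ℝ) ^ 2) ≤
      (((L + 1 : ℕ) : ℝ) ^ 2 * Real.log 4 - β * H.groundEnergy) / (β * ((L + 1 : ℕ) : ℝ) ^ 2) :=
    div_le_div_of_nonneg_right h2 hβL.le
  have e2' : (((L + 1 : ℕ) : ℝ) ^ 2 * Real.log 4 - β * H.groundEnergy) / (β * ((L + 1 : ℕ) : ℝ) ^ 2) =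
      Real.log 4 / β - H.groundEnergy / ((L + 1 : ℕ) : ℝ) ^ 2 := by
    rw [sub_div, mul_comm (((L + 1 : ℕ) : ℝ) ^ 2) (Real.log 4), mul_div_mul_right _ _ hL.ne',
      mul_div_mul_left _ _ hβ0.ne']
  rw [e1'] at e1
  rw [e2'] at e2
  constructor <;> linarith

end Seeded

end Summit.HubbardSuperconductivity.HubbardSuperconductivity.Cruxes.TwSeededEnsembleEquivalence.DrefuteSandwichLimit
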